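import Mathlib
import Literature.Analysis.OperatorTheory.ContractiveDetComplexity
import HarnessLib

/-!
# Crux `PriceOfContractivity` (stmt-ValiantsHypothesis-10583), line `birth` — stub
# `stub_sameSize_rankOne`: the rank-one (= linear polynomial) same-size partial case

Route `ValiantsHypothesis/ContractivityPrice`, crux K1
(`Summit.ValiantsHypothesis.ValiantsHypothesis.Theses.ContractivityPrice.PriceOfContractivity`):
a polynomial with an affine determinantal representation and no zero on the closed radius-`2`
polydisc has a contractive Sylvester realization `det (1 + diag (x ∘ κ) · K)`, `‖K‖_op ≤ 1`, of
quasi-polynomial size.  This file proves the registered partial case `stub_sameSize_rankOne` of the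
lead's skeleton (line `birth`, rev 3): if `K₀ = u vᵀ` has rank one, the pencil determinant is the
LINEAR polynomial

  `det (1 + diag (X ∘ κ) · u vᵀ) = 1 + ∑ i, u i v i · X (κ i) = 1 + ∑ e, a e · X e`,
  `a e = ∑_{κ i = e} u i v i`

(matrix determinant lemma, then grouping the rows by colour), zero-freeness on the closed
radius-`2` polydisc is exactly the `ℓ¹` condition `∑ e, |a e| ≤ 1/2` (evaluate at the point
`z e = -conj (a e) / (s |a e|)`, `s = ∑ |a e|`, which lies in the polydisc as soon as `s ≥ 1/2` and
is a zero), and the same polynomial is re-realised at the SAME size with the same colouring by the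
rank-one matrix `K₁ = w w'ᵀ` supported on one representative row per occurring colour
(`w i = √|a (κ i)|`, `w' i = (a (κ i) / |a (κ i)|) w i` on representatives), whose operator norm is
`≤ ‖w‖₂ ‖w'‖₂ ≤ ∑ e, |a e| ≤ 1/2`.  This is the rank-one instance of "no scaling gap".

References: the matrix determinant lemma (`Matrix.det_one_add_replicateCol_mul_replicateRow`);
Grinshpan–Kaliuzhnyi-Verbovetskyi–Woerdeman, Complex Anal. Oper. Theory 7 (2013), §3 (the
`ℓ¹`-type norm constraint for linear pencils).  Everything here is elementary and self-contained.
-/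

noncomputable section

-- single-conjunct layout: Sub = Summit, duplicated namespace component intended
set_option linter.dupNamespace false

namespace Summit.ValiantsHypothesis.ValiantsHypothesis.Theorems.PriceOfContractivity.RankOne

open MvPolynomial Matrix

/-! ### The pencil determinant of a rank-one matrix -/

/-- **Matrix determinant lemma for the pencil.** For a rank-one `K = w w'ᵀ`,
`det (1 + diag (X ∘ κ) · w w'ᵀ) = 1 + ∑ i, (w i * w' i) · X (κ i)`: indeed
`diag (X ∘ κ) · w w'ᵀ = (X ∘ κ · w) w'ᵀ` is again rank one and `det (1 + c rᵀ) = 1 + r · c`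
(`Matrix.det_one_add_replicateCol_mul_replicateRow`). [folklore] -/
theorem det_pencil_vecMulVec {R : ℕ} {σ : Type*} (w w' : Fin R → ℂ) (κ : Fin R → σ) :
    (1 + Matrix.diagonal (fun i => MvPolynomial.X (κ i)) *
        (Matrix.vecMulVec w w').map (fun a : ℂ => (MvPolynomial.C a : MvPolynomial σ ℂ))).det =
      1 + ∑ i, C (w i * w' i) * X (κ i) := by
  have hmap : (Matrix.vecMulVec w w').map (fun a : ℂ => (MvPolynomial.C a : MvPolynomial σ ℂ)) =
      Matrix.vecMulVec (fun i => C (w i)) (fun i => C (w' i)) := by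
    ext i j
    simp [Matrix.vecMulVec_apply]
  have hdot : (fun i => C (w' i)) ⬝ᵥ (Matrix.diagonal (fun i => (X (κ i) : MvPolynomial σ ℂ)) *ᵥ
      fun i => C (w i)) = ∑ i, C (w i * w' i) * X (κ i) := by
    simp only [dotProduct, mulVec_diagonal]
    refine Finset.sum_congr rfl fun i _ => ?_
    rw [map_mul]
    ring
  rw [hmap, Matrix.mul_vecMulVec, Matrix.vecMulVec_eq Unit,
    Matrix.det_one_add_replicateCol_mul_replicateRow, hdot]

/-- **Grouping the rows by colour.** `∑ i, c i · X (κ i) = ∑_{e ∈ κ(univ)} (∑_{κ i = e} c i) · X e`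
(`Finset.sum_image'`). [folklore] -/
theorem sum_C_mul_X_eq_sum_image {R : ℕ} {σ : Type*} [DecidableEq σ] (c : Fin R → ℂ)
    (κ : Fin R → σ) :
    ∑ i, C (c i) * (X (κ i) : MvPolynomial σ ℂ) =
      ∑ e ∈ Finset.univ.image κ,
        C (∑ i ∈ Finset.univ.filter (fun i => κ i = e), c i) * (X e : MvPolynomial σ ℂ) := by
  symm
  refine Finset.sum_image' (fun i => C (c i) * (X (κ i) : MvPolynomial σ ℂ)) fun i _ => ?_
  rw [map_sum, Finset.sum_mul]
  refine Finset.sum_congr rfl fun j hj => ?_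
  rw [(Finset.mem_filter.mp hj).2]

/-- Evaluating the linear polynomial `1 + ∑_{e ∈ S} a e · X e` at `z` gives `1 + ∑_{e ∈ S} a e z e`.
[folklore] -/
theorem eval_one_add_sum_C_mul_X {σ : Type*} (S : Finset σ) (a : σ → ℂ) (z : σ → ℂ) :
    MvPolynomial.eval z (1 + ∑ e ∈ S, C (a e) * (X e : MvPolynomial σ ℂ)) =
      1 + ∑ e ∈ S, a e * z e := by
  simp only [map_add, map_one, map_sum, map_mul, MvPolynomial.eval_C, MvPolynomial.eval_X]

/-! ### Zero-freeness on the closed radius-`2` polydisc is the `ℓ¹` condition -/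

/-- **The `ℓ¹` condition.** If the linear polynomial `1 + ∑_{e ∈ S} a e z e` has no zero with all
`|z e| ≤ 2`, then `∑_{e ∈ S} |a e| ≤ 1/2`: otherwise `s = ∑ |a e| > 1/2` and the point
`z e = -conj (a e) / (s |a e|)` has `|z e| = 1/s < 2` (or `z e = 0`) and
`1 + ∑ a e z e = 1 - (∑ |a e|) / s = 0`. [folklore] -/
theorem sum_norm_le_half {σ : Type*} (S : Finset σ) (a : σ → ℂ)
    (h : ∀ z : σ → ℂ, (∀ j, ‖z j‖ ≤ 2) → (1 : ℂ) + ∑ e ∈ S, a e * z e ≠ 0) :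
    ∑ e ∈ S, ‖a e‖ ≤ 1 / 2 := by
  by_contra hlt
  rw [not_le] at hlt
  set s : ℝ := ∑ e ∈ S, ‖a e‖ with hs
  have hs0 : 0 < s := lt_trans (by norm_num) hlt
  have hsne : ((s : ℝ) : ℂ) ≠ 0 := by exact_mod_cast hs0.ne'
  set z : σ → ℂ := fun e => -(starRingEnd ℂ (a e)) / ((s : ℂ) * (‖a e‖ : ℂ))
  refine h z (fun j => ?_) ?_
  · by_cases hj : a j = 0
    · simp [z, hj]
    · have hj' : 0 < ‖a j‖ := norm_pos_iff.mpr hj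
      simp only [z, norm_div, norm_neg, Complex.norm_conj, norm_mul, Complex.norm_real,
        Real.norm_of_nonneg hs0.le, Real.norm_of_nonneg hj'.le]
      rw [div_le_iff₀ (by positivity)]
      nlinarith [mul_pos (sub_pos.mpr hlt) hj']
  · have hterm : ∀ e ∈ S, a e * z e = -(((‖a e‖ : ℝ) : ℂ) / (s : ℂ)) := by
      intro e _
      by_cases he : a e = 0
      · simp [z, he]
      · have hne : ((‖a e‖ : ℝ) : ℂ) ≠ 0 := by exact_mod_cast (norm_pos_iff.mpr he).ne'
        simp only [z]
        rw [← mul_div_assoc, mul_neg, Complex.mul_conj', neg_div, neg_inj,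
          div_eq_div_iff (mul_ne_zero hsne hne) hsne]
        ring
    rw [Finset.sum_congr rfl hterm, Finset.sum_neg_distrib, ← Finset.sum_div,
      ← Complex.ofReal_sum, ← hs, div_self hsne, add_neg_cancel]

/-! ### One representative row per occurring colour -/

/-- **Representatives.** With `ρ = Function.invFun κ` (a right inverse of `κ` on its image), the
rows `i` with `ρ (κ i) = i` form a system of representatives of the occurring colours:
`∑ i, [ρ (κ i) = i] f (κ i) = ∑_{e ∈ κ(univ)} f e`. [folklore] -/
theorem sum_ite_invFun_eq {ι σ M : Type*} [Fintype ι] [DecidableEq ι] [Nonempty ι] [DecidableEq σ]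
    [AddCommMonoid M] (κ : ι → σ) (f : σ → M) :
    ∑ i, (if Function.invFun κ (κ i) = i then f (κ i) else 0) =
      ∑ e ∈ Finset.univ.image κ, f e := by
  symm
  refine Finset.sum_image' (fun i => if Function.invFun κ (κ i) = i then f (κ i) else 0)
    fun i _ => ?_
  rw [Finset.sum_eq_single (Function.invFun κ (κ i))]
  · have h1 : κ (Function.invFun κ (κ i)) = κ i := Function.invFun_eq ⟨i, rfl⟩
    rw [h1, if_pos rfl]
  · intro j hj hne
    rw [if_neg]
    intro hj'
    apply hne
    calc j = Function.invFun κ (κ j) := hj'.symm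
      _ = Function.invFun κ (κ i) := by rw [(Finset.mem_filter.mp hj).2]
  · intro hnot
    exact (hnot (Finset.mem_filter.mpr ⟨Finset.mem_univ _, Function.invFun_eq ⟨i, rfl⟩⟩)).elim

/-! ### The operator norm of a rank-one matrix -/

/-- **`‖w w'ᵀ‖_op ≤ ‖w‖₂ ‖w'‖₂`**: `(w w'ᵀ) x = (w' · x) w` and
`|w' · x| = |⟪conj w', x⟫| ≤ ‖w'‖₂ ‖x‖₂` (Cauchy–Schwarz in `EuclideanSpace ℂ (Fin R)`).
[folklore] -/
theorem norm_toEuclideanCLM_vecMulVec_le {R : ℕ} (w w' : Fin R → ℂ) :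
    ‖Matrix.toEuclideanCLM (𝕜 := ℂ) (Matrix.vecMulVec w w')‖ ≤
      ‖(WithLp.toLp 2 w : EuclideanSpace ℂ (Fin R))‖ *
        ‖(WithLp.toLp 2 w' : EuclideanSpace ℂ (Fin R))‖ := by
  refine ContinuousLinearMap.opNorm_le_bound _ (by positivity) fun x => ?_
  have h1 : Matrix.toEuclideanCLM (𝕜 := ℂ) (Matrix.vecMulVec w w') x =
      (w' ⬝ᵥ WithLp.ofLp x) • (WithLp.toLp 2 w : EuclideanSpace ℂ (Fin R)) := by
    apply WithLp.ofLp_injective 2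
    rw [Matrix.ofLp_toEuclideanCLM, Matrix.vecMulVec_mulVec, op_smul_eq_smul]
    rfl
  have h2 : w' ⬝ᵥ WithLp.ofLp x =
      @inner ℂ _ _ (WithLp.toLp 2 (star w') : EuclideanSpace ℂ (Fin R)) x := by
    rw [← WithLp.toLp_ofLp 2 x, EuclideanSpace.inner_toLp_toLp, star_star, WithLp.ofLp_toLp,
      WithLp.ofLp_toLp, dotProduct_comm]
  have h3 : ‖(WithLp.toLp 2 (star w') : EuclideanSpace ℂ (Fin R))‖ =
      ‖(WithLp.toLp 2 w' : EuclideanSpace ℂ (Fin R))‖ := by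
    rw [EuclideanSpace.norm_eq, EuclideanSpace.norm_eq]
    simp
  rw [h1, norm_smul, h2]
  calc ‖@inner ℂ _ _ (WithLp.toLp 2 (star w') : EuclideanSpace ℂ (Fin R)) x‖ *
        ‖(WithLp.toLp 2 w : EuclideanSpace ℂ (Fin R))‖
      ≤ (‖(WithLp.toLp 2 (star w') : EuclideanSpace ℂ (Fin R))‖ * ‖x‖) *
        ‖(WithLp.toLp 2 w : EuclideanSpace ℂ (Fin R))‖ := by
        gcongr
        exact norm_inner_le_norm _ _
    _ = _ := by rw [h3]; ring

/-! ### The stub -/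

/-- **Partial case (rank-one `K₀`) of the crux `PriceOfContractivity`, same size.** If
`K₀ = u vᵀ` has rank one then the pencil determinant `det (1 + diag (X ∘ κ) · K₀)` is the linear
polynomial `1 + ∑_e a e X e`, `a e = ∑_{κ i = e} u i v i`; if it has no zero on the closed
radius-`2` polydisc then `∑_e |a e| ≤ 1/2` (`sum_norm_le_half`), and the rank-one matrix
`K₁ = w w'ᵀ` supported on one representative row per occurring colour (`w i = √|a (κ i)|`,
`w' i = (a (κ i) / |a (κ i)|) · w i` there, `0` elsewhere) realises the same polynomial with the
same colouring at the same size, with `‖K₁‖_op ≤ ‖w‖₂ ‖w'‖₂ ≤ ∑_e |a e| ≤ 1/2`. (For `R = 0` the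
pencil is empty and `K₁ = K₀ = 0` works.) This is the registered stub `stub_sameSize_rankOne` of
the line `birth` of crux `stmt-ValiantsHypothesis-10583`, verbatim. [folklore] -/
theorem stub_sameSize_rankOne :
    ∀ (R : ℕ) {σ : Type} (K₀ : Matrix (Fin R) (Fin R) ℂ) (κ : Fin R → σ),
      (∃ u v : Fin R → ℂ, K₀ = Matrix.vecMulVec u v) →
      (∀ z : σ → ℂ, (∀ j, ‖z j‖ ≤ 2) → MvPolynomial.eval z (1 + Matrix.diagonal (fun i => MvPolynomial.X (κ i)) * K₀.map (fun a : ℂ => (MvPolynomial.C a : MvPolynomial σ ℂ))).det ≠ 0) →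
      ∃ (K₁ : Matrix (Fin R) (Fin R) ℂ) (κ₁ : Fin R → σ),
        ‖Matrix.toEuclideanCLM (𝕜 := ℂ) K₁‖ ≤ 1 / 2 ∧
        (1 + Matrix.diagonal (fun i => MvPolynomial.X (κ i)) * K₀.map (fun a : ℂ => (MvPolynomial.C a : MvPolynomial σ ℂ))).det =
          (1 + Matrix.diagonal (fun i => MvPolynomial.X (κ₁ i)) * K₁.map (fun a : ℂ => (MvPolynomial.C a : MvPolynomial σ ℂ))).det := by
  intro R σ K₀ κ hK₀ hz
  classical
  obtain ⟨u, v, rfl⟩ := hK₀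
  -- the colour classes and their coefficients
  set S : Finset σ := Finset.univ.image κ
  set a : σ → ℂ := fun e => ∑ i ∈ Finset.univ.filter (fun i => κ i = e), u i * v i
  have hdet : (1 + Matrix.diagonal (fun i => MvPolynomial.X (κ i)) *
      (Matrix.vecMulVec u v).map (fun a : ℂ => (MvPolynomial.C a : MvPolynomial σ ℂ))).det =
        1 + ∑ e ∈ S, C (a e) * (X e : MvPolynomial σ ℂ) := by
    rw [det_pencil_vecMulVec, sum_C_mul_X_eq_sum_image]
  -- zero-freeness on the closed radius-2 polydisc = the ℓ¹ condition
  have hsum : ∑ e ∈ S, ‖a e‖ ≤ 1 / 2 := by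
    refine sum_norm_le_half S a fun z hz2 => ?_
    have h := hz z hz2
    rwa [hdet, eval_one_add_sum_C_mul_X] at h
  rcases isEmpty_or_nonempty (Fin R) with hR | hR
  · -- `R = 0`: the pencil is empty, any `K₁` is `0`
    refine ⟨Matrix.vecMulVec u v, κ, ?_, rfl⟩
    rw [Subsingleton.elim (Matrix.vecMulVec u v) 0, map_zero, norm_zero]
    norm_num
  -- one representative row per occurring colour
  set ρ : σ → Fin R := Function.invFun κ
  set r : σ → ℝ := fun e => Real.sqrt ‖a e‖
  set p : σ → ℂ := fun e => a e / ((‖a e‖ : ℝ) : ℂ)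
  set w : Fin R → ℂ := fun i => if ρ (κ i) = i then ((r (κ i) : ℝ) : ℂ) else 0
  set w' : Fin R → ℂ := fun i => p (κ i) * w i
  have hrr : ∀ e, ((r e : ℝ) : ℂ) * ((r e : ℝ) : ℂ) = ((‖a e‖ : ℝ) : ℂ) := fun e => by
    rw [← Complex.ofReal_mul, Real.mul_self_sqrt (norm_nonneg _)]
  have hpa : ∀ e, p e * ((‖a e‖ : ℝ) : ℂ) = a e := fun e => by
    by_cases he : a e = 0
    · simp [p, he]
    · exact div_mul_cancel₀ _ (by exact_mod_cast (norm_pos_iff.mpr he).ne')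
  have hp1 : ∀ e, ‖p e‖ ≤ 1 := fun e => by
    simp only [p, norm_div, Complex.norm_real, norm_norm]
    exact div_self_le_one _
  have hww' : ∀ i, w i * w' i = if ρ (κ i) = i then a (κ i) else 0 := fun i => by
    simp only [w, w']
    split_ifs with h
    · rw [mul_left_comm, hrr, hpa]
    · rw [zero_mul]
  have hnw : ∀ i, ‖w i‖ ^ 2 = if ρ (κ i) = i then ‖a (κ i)‖ else 0 := fun i => by
    simp only [w]
    split_ifs with h
    · rw [Complex.norm_real, Real.norm_of_nonneg (Real.sqrt_nonneg _), Real.sq_sqrt (norm_nonneg _)]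
    · simp
  have hnw' : ∀ i, ‖w' i‖ ≤ ‖w i‖ := fun i => by
    simp only [w']
    rw [norm_mul]
    exact mul_le_of_le_one_left (norm_nonneg _) (hp1 _)
  have hnorm_w : ‖(WithLp.toLp 2 w : EuclideanSpace ℂ (Fin R))‖ ^ 2 = ∑ e ∈ S, ‖a e‖ := by
    rw [EuclideanSpace.norm_sq_eq]
    simp only [hnw]
    exact sum_ite_invFun_eq κ (fun e => ‖a e‖)
  have hnorm_w' : ‖(WithLp.toLp 2 w' : EuclideanSpace ℂ (Fin R))‖ ≤
      ‖(WithLp.toLp 2 w : EuclideanSpace ℂ (Fin R))‖ := by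
    rw [← sq_le_sq₀ (norm_nonneg _) (norm_nonneg _), EuclideanSpace.norm_sq_eq,
      EuclideanSpace.norm_sq_eq]
    exact Finset.sum_le_sum fun i _ => pow_le_pow_left₀ (norm_nonneg _) (hnw' i) 2
  refine ⟨Matrix.vecMulVec w w', κ, ?_, ?_⟩
  · -- the operator norm: `‖w w'ᵀ‖ ≤ ‖w‖₂ ‖w'‖₂ ≤ ‖w‖₂² = ∑ |a e| ≤ 1/2`
    calc ‖Matrix.toEuclideanCLM (𝕜 := ℂ) (Matrix.vecMulVec w w')‖
        ≤ ‖(WithLp.toLp 2 w : EuclideanSpace ℂ (Fin R))‖ *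
            ‖(WithLp.toLp 2 w' : EuclideanSpace ℂ (Fin R))‖ :=
          norm_toEuclideanCLM_vecMulVec_le w w'
      _ ≤ ‖(WithLp.toLp 2 w : EuclideanSpace ℂ (Fin R))‖ *
            ‖(WithLp.toLp 2 w : EuclideanSpace ℂ (Fin R))‖ := by gcongr
      _ = ∑ e ∈ S, ‖a e‖ := by rw [← sq, hnorm_w]
      _ ≤ 1 / 2 := hsum
  · -- the determinant: both sides are `1 + ∑_e a e X e`
    rw [hdet, det_pencil_vecMulVec]
    simp only [hww', apply_ite MvPolynomial.C, MvPolynomial.C_0, ite_mul, zero_mul]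
    exact congrArg (fun q : MvPolynomial σ ℂ => 1 + q)
      (sum_ite_invFun_eq κ (fun e => C (a e) * (X e : MvPolynomial σ ℂ))).symm

end Summit.ValiantsHypothesis.ValiantsHypothesis.Theorems.PriceOfContractivity.RankOne
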